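import Mathlib
import Summits.Ventures.HodgeRepro.Tier4.Target
import Summits.Ventures.HodgeRepro.Tier4.Common.TargetBall
import Summits.Ventures.HodgeRepro.Tier4.Common.TargetCalculus
import Summits.Ventures.HodgeRepro.Tier4.Common.AutForms
import Summits.Ventures.HodgeRepro.Tier4.Line3.KMDatumS
import Summits.Ventures.HodgeRepro.Tier4.Line3.Defs
import Summits.Ventures.HodgeRepro.Tier4.Line3.HeckeEquivarianceLemmas
import Summits.Ventures.HodgeRepro.Tier4.Line3.MajorantLemmas

/-!
# Tier4/Line3/IntegrableMajorant — lemma L3.2a `integrable_majorant` of LINE L3 (the majorant is integrable)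

Blind re-derivation cell `pub-hodge-repro`, Tier 4 «PROVE THE STEP» (README §9–§10), seat t4-L2-p1 (gen 0), re-pointed
to LINE L3 by the lead (S12208).  LINE L3 = `Tier4/Line3/Skeleton.lean` v0.14 (t4-plan-3): the statement of L3.2a is
byte-identical to v0.9's; v0.10 changed ONE definition on the repair accepted in S12250 — the chosen fundamental
domain `T4Data.domain K` is one that STAYS AWAY FROM THE BOUNDARY (`∃ r < 1, ∀ z ∈ D, nsq z ≤ r`), or `∅` — so that
L3.2a needs neither the `Γ′`-invariance of the majorant density nor Godement's compactness criterion (which would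
otherwise be a printed input; it now sits in L3.c alone, displayed by its prover); v0.14 made the datumS sesquilinear
(weight `0` under the unit scalars), which this proof consumes only through `ThetaData.{equiv, weight, summable}`.

THE LEMMA (verbatim): `theorem T4Data.integrable_majorant (D : X.ThetaData) (K : X.Level) (γ : X.Tr K) :
IntegrableOn (fun z => ∑' w : X.LineTuple, ‖X.summand D.Φ D.cf γ w z‖) (X.domain K)`.

PROOF (namespace `IntegrableMajorant`; no printed input, no invariance):
* `domain_nsq_le`: the chosen domain lies in the compact `K₀ = {nsq ≤ r} ⊆ 𝔹` for some `r < 1` (its definition).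
* **A** `exists_majorant_mulVec` — for one coset representative `r ∈ U(H)(E′)`: `ThetaData.equiv` at `M(r) =
  toBallMat τ₀ C r` (unitary for `J`, `toBallMat_J_of_unitary`) writes `Φ(y(x), z)_k` as `Σ_l Φ(y(r x), M(r) z)_l ·
  ∂_k (actM M(r))_l z`; `ThetaData.summable` on the compact `M(r) K₀` majorises `‖cf_j(x′) Φ(y(x′), z′)_l‖` over the
  lines, the summand is a function of the line (`summand_out_mk`: weight `+1` of `cf` against weight `−1` of the
  datumS), `o ↦ r · o` is a bijection of the lines (`lineEquiv`), and `∂_k (actM M(r))_l` is bounded on `K₀`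
  (`exists_bound_pd_actM`: `ContDiffOn.div` + `continuousOn_fderiv_of_isOpen`).
* **B** `exists_majorant_heckeAct` — the Hecke-moved coefficient function `(h · cf_j)(x) = Σ_terms n Σ_{r ∈ R} cf_j(r x)`
  is a finite sum over representatives in `U(H)(E′)` (`isUnitaryOf_of_isFor`): finite sums of the majorants of A.
* **C** `exists_majorant_summand` — `‖coefQ(γ)(w) F(w, z)‖ ≤ Σ_{h ∈ supp γ} ‖a_h‖ Π_j (|g_{h,j,0}(w_j)| + |g_{h,j,1}(w_j)|)`
  (`‖a ∧ b‖ ≤ (‖a₀‖ + ‖a₁‖)(‖b₀‖ + ‖b₁‖)`), summable over `LineTuple = Fin 4 → Line` (`summable_pi_prod`).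
* **D** `integrableOn_tsum_norm_summand` — on any measurable `S ⊆ {nsq ≤ r}`: the majorant is continuous on `{nsq ≤ r}`
  (Weierstrass M-test `continuousOn_tsum` with C; `continuousOn_wedge_datum'` of `MajorantLemmas`), bounded by `Σ_w G w`,
  and `S` has finite measure: `IntegrableOn.of_bound`.

Imports: Mathlib, `Tier4/Target`, `Tier4/Common/{TargetBall, TargetCalculus, AutForms}`, `Tier4/Line3/{Defs,
HeckeEquivarianceLemmas}` (t4-L3-p2) and the support module `Tier4/Line3/MajorantLemmas` (this seat).
`#print axioms T4Data.integrable_majorant = [propext, Classical.choice, Quot.sound]` (farm, on the concatenation of the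
imported modules with Skeleton v0.14's definitions, 2026-08-28T20:2xZ).
Nothing here says anything about the status of the Hodge conjecture for CM abelian varieties, which is NOT proved
(HC_CM is NOT proved by anyone in this repository).
-/

set_option autoImplicit false

noncomputable section

namespace Summit.Ventures.HodgeRepro.Tier4.Line3

open Summit.Ventures.HodgeRepro.Tier4
open Matrix MeasureTheory
open scoped ComplexConjugate

namespace IntegrableMajorant

open HeckeEquivariance

/-! ### 3. One coset representative: the slot majorant transported through `r ∈ U(H)(E′)` -/

variable (X : T4Data)

/-- **A.** For `r ∈ U(H)(E′)` and a compact `K₀ ⊆ 𝔹`, the series `Σ_lines ‖cf_j(r x) Φ(y(x), z)_k‖` has a summable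
majorant uniform in `z ∈ K₀`: `ThetaData.equiv` at `M(r)` moves the datumS to `(y(r x), M(r) z)`, where
`ThetaData.summable` on the compact `M(r) K₀` applies (line-invariance of the summand, the bijection `o ↦ r · o`,
boundedness of `∂ actM(M(r))` on `K₀`). -/
theorem exists_majorant_mulVec (D : X.ThetaData) (j : Fin 4) {r : Matrix (Fin 3) (Fin 3) X.E}
    (hr : IsUnitaryOf X.c X.H r) {K₀ : Set (Fin 2 → ℂ)} (hK : IsCompact K₀) (hKb : K₀ ⊆ ball) (k : Fin 2) :
    ∃ g : X.Line → ℝ, Summable g ∧ ∀ z ∈ K₀, ∀ o : X.Line,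
      ‖D.cf j (r *ᵥ Quot.out o) * datumS D.Φ (X.ballCoord (Quot.out o)) z k‖ ≤ g o := by
  have hM : (toBallMat X.τ₀ X.C r)ᴴ * J * toBallMat X.τ₀ X.C r = J := toBallMat_J_of_unitary X hr
  have hKM : IsCompact (actM (toBallMat X.τ₀ X.C r) '' K₀) :=
    hK.image_of_continuousOn ((continuousOn_actM hM).mono hKb)
  have hKMb : actM (toBallMat X.τ₀ X.C r) '' K₀ ⊆ ball := by
    rintro _ ⟨z, hz, rfl⟩
    exact actM_mem_ball hM (hKb hz)
  have hg : ∀ l : Fin 2, ∃ g : X.Line → ℝ, Summable g ∧ ∀ z ∈ actM (toBallMat X.τ₀ X.C r) '' K₀, ∀ o : X.Line,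
      ‖D.cf j (Quot.out o) * datumS D.Φ (X.ballCoord (Quot.out o)) z l‖ ≤ g o :=
    fun l => D.summable j _ hKM hKMb l
  choose g hgs hgb using hg
  have hB : ∀ l : Fin 2, ∃ B : ℝ, ∀ z ∈ K₀, ‖pd k (fun w => actM (toBallMat X.τ₀ X.C r) w l) z‖ ≤ B :=
    fun l => exists_bound_pd_actM hM hK hKb k l
  choose B hB using hB
  have hr' : IsUnit r.det := isUnit_det_of_isUnitaryOf X hr
  refine ⟨fun o => ∑ l : Fin 2, B l * g l (lineEquiv X r hr' o), ?_, ?_⟩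
  · exact summable_sum fun l _ => ((lineEquiv X r hr').summable_iff.mpr (hgs l)).mul_left (B l)
  · intro z hz o
    have hE := D.equiv (toBallMat X.τ₀ X.C r) (isUnitaryOf_J_of_conjTranspose hM) (X.ballCoord (Quot.out o))
      z (hKb hz) k
    rw [← hE, Finset.mul_sum]
    refine (norm_sum_le _ _).trans (Finset.sum_le_sum fun l _ => ?_)
    rw [← ballCoord_mulVec, ← mul_assoc, norm_mul]
    have h1 : ‖D.cf j (r *ᵥ Quot.out o) *
        datumS D.Φ (X.ballCoord (r *ᵥ Quot.out o)) (actM (toBallMat X.τ₀ X.C r) z) l‖ ≤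
        g l (lineEquiv X r hr' o) := by
      have := hgb l (actM (toBallMat X.τ₀ X.C r) z) ⟨z, hz, rfl⟩ (lineEquiv X r hr' o)
      rw [lineEquiv_apply] at this ⊢
      rwa [summand_out_mk X D.Φ (D.cf j) (D.weight j)] at this
    calc ‖D.cf j (r *ᵥ Quot.out o) *
          datumS D.Φ (X.ballCoord (r *ᵥ Quot.out o)) (actM (toBallMat X.τ₀ X.C r) z) l‖ *
          ‖pd k (fun w => actM (toBallMat X.τ₀ X.C r) w l) z‖
        ≤ g l (lineEquiv X r hr' o) * B l :=
          mul_le_mul h1 (hB l z hz) (norm_nonneg _) ((norm_nonneg _).trans h1)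
      _ = B l * g l (lineEquiv X r hr' o) := mul_comm _ _

/-! ### 4. The Hecke-moved coefficient functions -/

/-- **B.** For a Hecke element `h` of level `K` and a compact `K₀ ⊆ 𝔹`, the series
`Σ_lines ‖(h · cf_j)(x) Φ(y(x), z)_k‖` has a summable majorant uniform in `z ∈ K₀` (finite sums over the terms and
the coset representatives, each in `U(H)(E′)`, of the majorants of A). -/
theorem exists_majorant_heckeAct (D : X.ThetaData) (j : Fin 4) (K : X.Level) {h : HeckeElement X.E}
    (hh : h.IsFor X.c X.H K.1) {K₀ : Set (Fin 2 → ℂ)} (hK : IsCompact K₀) (hKb : K₀ ⊆ ball) (k : Fin 2) :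
    ∃ g : X.Line → ℝ, Summable g ∧ ∀ z ∈ K₀, ∀ o : X.Line,
      ‖X.heckeAct h (D.cf j) (Quot.out o) * datumS D.Φ (X.ballCoord (Quot.out o)) z k‖ ≤ g o := by
  have hA : ∀ r : Matrix (Fin 3) (Fin 3) X.E, ∃ g : X.Line → ℝ, Summable g ∧
      (IsUnitaryOf X.c X.H r → ∀ z ∈ K₀, ∀ o : X.Line,
        ‖D.cf j (r *ᵥ Quot.out o) * datumS D.Φ (X.ballCoord (Quot.out o)) z k‖ ≤ g o) := by
    intro r
    by_cases hr : IsUnitaryOf X.c X.H r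
    · obtain ⟨g, hgs, hgb⟩ := exists_majorant_mulVec X D j hr hK hKb k
      exact ⟨g, hgs, fun _ => hgb⟩
    · exact ⟨0, summable_zero, fun h' => absurd h' hr⟩
  choose g hgs hgb using hA
  refine ⟨fun o => (h.terms.map (fun t => |(t.1 : ℝ)| * ∑ r ∈ t.2, g r o)).sum, ?_, ?_⟩
  · exact summable_list_sum _ _ (fun t _ => (summable_sum (fun r _ => hgs r)).mul_left _)
  · intro z hz o
    unfold T4Data.heckeAct
    rw [← List.sum_map_mul_right]
    refine (norm_list_sum_le _ _).trans (list_sum_le_list_sum _ _ _ fun t ht => ?_)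
    rw [zsmul_eq_mul, mul_assoc, norm_mul, Finset.sum_mul]
    have hn : ‖((t.1 : ℤ) : ℂ)‖ = |(t.1 : ℝ)| := by exact_mod_cast Complex.norm_intCast t.1
    rw [hn]
    refine mul_le_mul_of_nonneg_left ((norm_sum_le _ _).trans (Finset.sum_le_sum fun r hr => ?_)) (abs_nonneg _)
    exact hgb r (isUnitaryOf_of_isFor X K hh ht hr) z hz o

/-! ### 5. The quadruple summand -/

/-- **C.** The quadruple summands `coefQ(γ)(w) · F(w, z)` have a summable majorant over the line tuples, uniform in
`z` on a compact `K₀ ⊆ 𝔹`: the finite sum over the support of `γ` of `‖a_h‖` times the product over the four slots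
of the majorants of B (both components of the datumS). -/
theorem exists_majorant_summand (D : X.ThetaData) (K : X.Level) (γ : X.Tr K) {K₀ : Set (Fin 2 → ℂ)}
    (hK : IsCompact K₀) (hKb : K₀ ⊆ ball) :
    ∃ G : X.LineTuple → ℝ, Summable G ∧ ∀ z ∈ K₀, ∀ w : X.LineTuple, ‖X.summand D.Φ D.cf γ w z‖ ≤ G w := by
  have hS : ∀ (h : X.TrZ K) (j : Fin 4) (k : Fin 2), ∃ g : X.Line → ℝ, Summable g ∧ ∀ z ∈ K₀, ∀ o : X.Line,
      ‖X.heckeAct (h.1 (X.slot j)) (D.cf j) (Quot.out o) * datumS D.Φ (X.ballCoord (Quot.out o)) z k‖ ≤ g o :=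
    fun h j k => exists_majorant_heckeAct X D j K (h.2 (X.slot j)) hK hKb k
  choose g hgs hgb using hS
  let γ' : X.TrZ K →₀ ℂ := γ
  -- the slot majorant `|g h j 0| + |g h j 1|` (non-negative, summable)
  refine ⟨fun w => ∑ h ∈ γ'.support, ‖γ' h‖ * ∏ j, (|g h j 0 (w j)| + |g h j 1 (w j)|), ?_, ?_⟩
  · refine summable_sum fun h _ => Summable.mul_left _ ?_
    exact summable_pi_prod (fun j o => |g h j 0 o| + |g h j 1 o|)
      (fun j => (hgs h j 0).abs.add (hgs h j 1).abs) (fun j o => add_nonneg (abs_nonneg _) (abs_nonneg _))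
  · intro z hz w
    -- the per-slot bounds
    have hb : ∀ (h : X.TrZ K) (j : Fin 4) (k : Fin 2),
        ‖X.heckeAct (h.1 (X.slot j)) (D.cf j) (Quot.out (w j))‖ *
          ‖datumS D.Φ (X.ballCoord (Quot.out (w j))) z k‖ ≤ |g h j k (w j)| := fun h j k => by
      rw [← norm_mul]
      exact (hgb h j k z hz (w j)).trans (le_abs_self _)
    have hslot : ∀ (h : X.TrZ K) (j : Fin 4),
        ‖X.heckeAct (h.1 (X.slot j)) (D.cf j) (Quot.out (w j))‖ *
          (‖datumS D.Φ (X.ballCoord (Quot.out (w j))) z 0‖ + ‖datumS D.Φ (X.ballCoord (Quot.out (w j))) z 1‖) ≤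
          |g h j 0 (w j)| + |g h j 1 (w j)| := fun h j => by
      rw [mul_add]
      exact add_le_add (hb h j 0) (hb h j 1)
    unfold T4Data.summand T4Data.kernel T4Data.coefQ T4Data.rep
    rw [Finsupp.sum, Finset.sum_mul]
    refine (norm_sum_le _ _).trans (Finset.sum_le_sum fun h _ => ?_)
    rw [Fin.prod_univ_four]
    simp only [norm_mul, Complex.norm_conj]
    -- abbreviations
    set A0 := ‖X.heckeAct (h.1 (X.slot 0)) (D.cf 0) (Quot.out (w 0))‖
    set A1 := ‖X.heckeAct (h.1 (X.slot 1)) (D.cf 1) (Quot.out (w 1))‖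
    set A2 := ‖X.heckeAct (h.1 (X.slot 2)) (D.cf 2) (Quot.out (w 2))‖
    set A3 := ‖X.heckeAct (h.1 (X.slot 3)) (D.cf 3) (Quot.out (w 3))‖
    have hw01 := norm_wedge_le (datumS D.Φ (X.ballCoord (Quot.out (w 0))) z) (datumS D.Φ (X.ballCoord (Quot.out (w 1))) z)
    have hw23 := norm_wedge_le (datumS D.Φ (X.ballCoord (Quot.out (w 2))) z) (datumS D.Φ (X.ballCoord (Quot.out (w 3))) z)
    have h0 := hslot h 0
    have h1 := hslot h 1
    have h2 := hslot h 2
    have h3 := hslot h 3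
    have hA0 : 0 ≤ A0 := norm_nonneg _
    have hA1 : 0 ≤ A1 := norm_nonneg _
    have hA2 : 0 ≤ A2 := norm_nonneg _
    have hA3 : 0 ≤ A3 := norm_nonneg _
    have hD : ∀ (j : Fin 4) (k : Fin 2), 0 ≤ ‖datumS D.Φ (X.ballCoord (Quot.out (w j))) z k‖ := fun j k => norm_nonneg _
    have key : A0 * A1 * (A2 * A3) * (‖wedge (datumS D.Φ (X.ballCoord (Quot.out (w 0))) z) (datumS D.Φ (X.ballCoord (Quot.out (w 1))) z)‖ *
        ‖wedge (datumS D.Φ (X.ballCoord (Quot.out (w 2))) z) (datumS D.Φ (X.ballCoord (Quot.out (w 3))) z)‖) ≤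
        (|g h 0 0 (w 0)| + |g h 0 1 (w 0)|) * (|g h 1 0 (w 1)| + |g h 1 1 (w 1)|) *
          (|g h 2 0 (w 2)| + |g h 2 1 (w 2)|) * (|g h 3 0 (w 3)| + |g h 3 1 (w 3)|) := by
      calc A0 * A1 * (A2 * A3) * (‖wedge _ _‖ * ‖wedge _ _‖)
          ≤ A0 * A1 * (A2 * A3) *
            (((‖datumS D.Φ (X.ballCoord (Quot.out (w 0))) z 0‖ + ‖datumS D.Φ (X.ballCoord (Quot.out (w 0))) z 1‖) *
              (‖datumS D.Φ (X.ballCoord (Quot.out (w 1))) z 0‖ + ‖datumS D.Φ (X.ballCoord (Quot.out (w 1))) z 1‖)) *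
             ((‖datumS D.Φ (X.ballCoord (Quot.out (w 2))) z 0‖ + ‖datumS D.Φ (X.ballCoord (Quot.out (w 2))) z 1‖) *
              (‖datumS D.Φ (X.ballCoord (Quot.out (w 3))) z 0‖ + ‖datumS D.Φ (X.ballCoord (Quot.out (w 3))) z 1‖))) := by
            gcongr
        _ = (A0 * (‖datumS D.Φ (X.ballCoord (Quot.out (w 0))) z 0‖ + ‖datumS D.Φ (X.ballCoord (Quot.out (w 0))) z 1‖)) *
            (A1 * (‖datumS D.Φ (X.ballCoord (Quot.out (w 1))) z 0‖ + ‖datumS D.Φ (X.ballCoord (Quot.out (w 1))) z 1‖)) *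
            (A2 * (‖datumS D.Φ (X.ballCoord (Quot.out (w 2))) z 0‖ + ‖datumS D.Φ (X.ballCoord (Quot.out (w 2))) z 1‖)) *
            (A3 * (‖datumS D.Φ (X.ballCoord (Quot.out (w 3))) z 0‖ + ‖datumS D.Φ (X.ballCoord (Quot.out (w 3))) z 1‖)) := by
            ring
        _ ≤ _ := by
            gcongr
    calc ‖γ' h‖ * (A0 * A1) * (A2 * A3) * (‖wedge _ _‖ * ‖wedge _ _‖)
        = ‖γ' h‖ * (A0 * A1 * (A2 * A3) * (‖wedge _ _‖ * ‖wedge _ _‖)) := by ring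
      _ ≤ ‖γ' h‖ * ((|g h 0 0 (w 0)| + |g h 0 1 (w 0)|) * (|g h 1 0 (w 1)| + |g h 1 1 (w 1)|) *
          (|g h 2 0 (w 2)| + |g h 2 1 (w 2)|) * (|g h 3 0 (w 3)| + |g h 3 1 (w 3)|)) :=
          mul_le_mul_of_nonneg_left key (norm_nonneg _)

/-! ### 6. Integrability of the majorant over a measurable set staying away from `∂𝔹` -/

/-- Absolute convergence of the quadruple series at every point of the ball (the majorant of C on the compact `{z}`). -/
theorem summable_norm_summand (D : X.ThetaData) {K : X.Level} (γ : X.Tr K) {z : Fin 2 → ℂ} (hz : z ∈ ball) :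
    Summable (fun w : X.LineTuple => ‖X.summand D.Φ D.cf γ w z‖) := by
  obtain ⟨G, hGs, hGb⟩ := exists_majorant_summand X D K γ isCompact_singleton (Set.singleton_subset_iff.mpr hz)
  exact Summable.of_nonneg_of_le (fun _ => norm_nonneg _) (fun w => hGb z rfl w) hGs

/-- **D.** On a measurable set `S ⊆ {nsq ≤ r}`, `r < 1`, the majorant `z ↦ Σ_w ‖summand w z‖` is integrable: it is
continuous on the compact `{nsq ≤ r}` (Weierstrass M-test with the majorant of C) and bounded there by `Σ_w G w`. -/
theorem integrableOn_tsum_norm_summand (D : X.ThetaData) (K : X.Level) (γ : X.Tr K) {S : Set (Fin 2 → ℂ)}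
    (hS : MeasurableSet S) {r : ℝ} (hr : r < 1) (hSr : ∀ z ∈ S, nsq z ≤ r) :
    IntegrableOn (fun z => ∑' w : X.LineTuple, ‖X.summand D.Φ D.cf γ w z‖) S := by
  have hK : IsCompact {z : Fin 2 → ℂ | nsq z ≤ r} := isCompact_nsq_le' r hr.le
  have hKb : {z : Fin 2 → ℂ | nsq z ≤ r} ⊆ ball := fun z hz => lt_of_le_of_lt hz hr
  have hSK : S ⊆ {z : Fin 2 → ℂ | nsq z ≤ r} := fun z hz => hSr z hz
  obtain ⟨G, hGs, hGb⟩ := exists_majorant_summand X D K γ hK hKb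
  have hcont : ∀ w : X.LineTuple,
      ContinuousOn (fun z => ‖X.summand D.Φ D.cf γ w z‖) {z : Fin 2 → ℂ | nsq z ≤ r} := by
    intro w
    refine ContinuousOn.norm ?_
    unfold T4Data.summand T4Data.kernel
    exact (continuousOn_const.mul ((continuousOn_wedge_datum' D.Φ _ _).mul
      (Complex.continuous_conj.comp_continuousOn (continuousOn_wedge_datum' D.Φ _ _)))).mono hKb
  have hM : ContinuousOn (fun z => ∑' w : X.LineTuple, ‖X.summand D.Φ D.cf γ w z‖)
      {z : Fin 2 → ℂ | nsq z ≤ r} :=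
    continuousOn_tsum hcont hGs (fun w z hz => by rw [norm_norm]; exact hGb z hz w)
  refine IntegrableOn.of_bound (lt_of_le_of_lt (measure_mono hSK) hK.measure_lt_top)
    ((hM.mono hSK).aestronglyMeasurable hS) (∑' w, G w) ?_
  refine (ae_restrict_mem hS).mono fun z hz => ?_
  rw [Real.norm_eq_abs, abs_of_nonneg (tsum_nonneg fun w => norm_nonneg _)]
  exact (Summable.of_nonneg_of_le (fun w => norm_nonneg _) (fun w => hGb z (hSK hz) w) hGs).tsum_le_tsum
    (fun w => hGb z (hSK hz) w) hGs

/-! ### 7. The chosen fundamental domain -/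

/-- The chosen domain lies in the ball. -/
theorem domain_subset_ball (K : X.Level) : X.domain K ⊆ ball := by
  unfold T4Data.domain
  split_ifs with hD
  · exact (Classical.choose_spec hD).1.2.1
  · exact Set.empty_subset _

/-- The chosen domain is measurable (a fundamental domain or `∅`). -/
theorem measurableSet_domain (K : X.Level) : MeasurableSet (X.domain K) := by
  unfold T4Data.domain
  split_ifs with hD
  · exact (Classical.choose_spec hD).1.1
  · exact MeasurableSet.empty

/-- The chosen domain stays away from the boundary: `X.domain K ⊆ {nsq ≤ r}` for some `r < 1` (by its definition: the
chosen fundamental domain is one with this property, or `∅`). -/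
theorem domain_nsq_le (K : X.Level) : ∃ r : ℝ, r < 1 ∧ ∀ z ∈ X.domain K, nsq z ≤ r := by
  unfold T4Data.domain
  split_ifs with hD
  · exact (Classical.choose_spec hD).2
  · exact ⟨0, zero_lt_one, fun z hz => absurd hz (Set.notMem_empty z)⟩

/-- **L3.2a for a chosen domain staying away from the boundary**: if `X.domain K ⊆ {nsq ≤ r}` for some `r < 1`, the
majorant is integrable over it. -/
theorem integrable_majorant_of_nsq_le (D : X.ThetaData) (K : X.Level) (γ : X.Tr K) {r : ℝ} (hr : r < 1)
    (hDr : ∀ z ∈ X.domain K, nsq z ≤ r) :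
    IntegrableOn (fun z => ∑' w : X.LineTuple, ‖X.summand D.Φ D.cf γ w z‖) (X.domain K) :=
  integrableOn_tsum_norm_summand X D K γ (measurableSet_domain X K) hr hDr

end IntegrableMajorant

namespace T4Data

variable (X : T4Data)

/-- **L3.2a INTEGRABILITY OF THE MAJORANT (prover item).** The series of absolute values of the quadruple summands is
integrable over the chosen fundamental domain: locally uniform convergence on the ball (Gaussian decay on the
lattices of `support`, polynomial growth of the datum), `Γ′`-invariance of the majorant density (`invΓ`, `equiv`) and
compactness of `Γ′\𝔹` (`V` anisotropic — `X.hAn`, `X.hDef`; Godement).  Statement verbatim from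
`Tier4/Line3/Skeleton.lean` v0.23 L851–L853 (v0.15 added the pointwise-summability conjunct); proof = the Weierstrass
M-test of `IntegrableMajorant` on the compact `{nsq ≤ r}` containing the chosen domain (`domain_nsq_le`) — no
invariance and no printed input enter. -/
theorem integrable_majorant (D : X.ThetaData) (K : X.Level) (γ : X.Tr K) :
    (∀ z ∈ X.domain K, Summable (fun w : X.LineTuple => ‖X.summand D.Φ D.cf γ w z‖)) ∧
      IntegrableOn (fun z => ∑' w : X.LineTuple, ‖X.summand D.Φ D.cf γ w z‖) (X.domain K) := by
  obtain ⟨r, hr, hDr⟩ := IntegrableMajorant.domain_nsq_le X K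
  exact ⟨fun z hz => IntegrableMajorant.summable_norm_summand X D γ (IntegrableMajorant.domain_subset_ball X K hz),
    IntegrableMajorant.integrable_majorant_of_nsq_le X D K γ hr hDr⟩

end T4Data

end Summit.Ventures.HodgeRepro.Tier4.Line3

end
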